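import Summits.SmoothPoincare4.SmoothPoincare4.Theses.EntropyRung
import Summits.SmoothPoincare4.SmoothPoincare4.Theorems.ConicalGap.Negative.LoadBearingHypotheses

/-!
# Crux `EntropyRung.ConicalGap` (stmt-SmoothPoincare4-16589) — line `confined-kaehler-split`, skeleton v1

Crux-strategist seat (WALL-BREAKER on the exhausted chain, 2026-08-17; census `Cruxes/ConicalGap/STRATEGY-CENSUS.md`,
card `Lines/confined-kaehler-split.md`, glue also published as `Cruxes/ConicalGap/SplitGlue.lean`).

The dead line `Sketch` (Wang–Wang density transform) and all six triaged ideas died at one place: every sufficient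
condition for the bound `Θ ≤ Θ(S³×ℝ)` on the asymptotically conical class must contain an EXPLICIT rigidity of the
Gaussian soliton among AC 4-d shrinkers (TRIAGE-r2-3; `Lines/Sketch-dead.md` §3) — an input of a different KIND from
identities, comparison geometry, Picone positivity or Gauss–Bonnet bookkeeping, all of which are equalities or void on
the Gaussian / `S⁴` models.  This line does not pretend to have that input.  It PARTITIONS the crux class along the two
inputs of a different kind that exist today, so that the known part closes, the summit-relevant part is isolated with a
new (topological) hypothesis, and the gratuitous part is marked:

* `stub_kaehlerConicalGap` (K — KNOWN IN PRINT): the gap on the Kähler AC class (a `g`-orthogonal almost complex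
  structure `J`, `J² = −1`, parallel: `∇(JY) = J∇Y` on differentiable fields).  Conlon–Deruelle–Sun, Geom. Topol. 28
  (2024) = arXiv:1904.00147, Thm E(3) [arXiv: Thm 5(3), "Classification of shrinkers"]: a complete shrinking gradient Kähler–Ricci soliton surface with `R → 0` at infinity
  is, up to `GL(2,ℂ)`-pullback, the flat Gaussian (excluded by non-flatness) or FIK on `O(−1)`; `Θ(FIK) = e^{√2−2}(1+√2)/2
  = .672 < .791` (CHI 2004 §4; arithmetic `Disproof.fikDensity_lt_thetaCyl`).  (A gradient shrinker whose metric is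
  Kähler is a Kähler–Ricci shrinker: `Hess f = g/2 − Ric` is `J`-invariant.)  Lean debt: CDS Thm E(3) as a named fact over
  this inline predicate + FIK's weighted volume in the tree's vocabulary.
* `stub_confinedNonKaehlerConicalGap` (C — THE SUMMIT-RELEVANT OPEN CORE, hardest): the gap for NON-Kähler AC shrinkers
  that are CONFINED — one smooth closed `S ≃ₕ S⁴` receives an open smooth embedding of every sublevel set `{f < t}`.
  This is exactly the instance `closes` consumes: `RecognitionOfShrinkerGaps` meets the gap only at blow-up limits of
  Ricci flows on `M ≃ₕ S⁴`, which are smooth pointed limits, so their compact sublevel sets embed back into `M` (card g17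
  `confined-psc-link-census`; lead c2 §2; parent Disproof 10(vi)).  No member of the class is known; a counterexample
  must be a non-Kähler AC shrinker on a spin open 4-manifold with zero intersection pairing whose PSC cone links embed in a
  homotopy 4-sphere (e.g. `ℝ⁴`, or `S²×ℝ²` with a conical end) — cohomogeneity-one families there are scanned empty.
* `stub_unconfinedNonKaehlerConicalGap` (U — NOT NEEDED BY THE SUMMIT once the rung is re-glued along confinement): the
  gap for non-Kähler UNCONFINED AC shrinkers (`O(−k)`-type topology, non-embeddable links).  Disprover territory:
  triaxial `SU(2)` bolts on `O(−1), O(−2), O(−4)` (Donovan arXiv:2503.15033 Lemma 3.6; strategist kit job j023356),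
  cohomogeneity-two non-Kähler families.

`ConicalGap_of` concludes the crux BY NAME from the three stubs by excluded middle (the arrow form with the stub signatures as hypotheses is `Theorems.conicalGap_of_subs` of `SplitGlue.lean`) (partition ⇒ `K ∧ C ∧ U ⇔ crux`,
`SplitGlue.conicalGap_iff_subs`; nothing smuggled, no stub restates the crux: each is the crux on a STRICT sub-class,
`SplitGlue.*_of_conicalGap`).  Disproof used: the three `_false_without_` witnesses of `Cruxes/ConicalGap/Disproof.lean`
keep their force stub-wise — non-flatness (Gaussian: Kähler AND confined, so it sits under K's and C's hypotheses and is
excluded only by `∃ x, R x ≠ 0`, which every stub keeps), non-compactness (`S⁴(√6)`, kept), completeness (the incomplete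
Calabi family is Kähler: K keeps completeness); the landed Negative lemmas (`LoadBearingHypotheses`, imported) refute no
stub instance.  `sorry` lives ONLY in the three `stub_*` theorems.
-/

noncomputable section

set_option linter.dupNamespace false

open scoped Manifold ContDiff ENNReal NNReal Topology
open MeasureTheory Set Filter
open Literature.Geometry.Lorentzian Literature.Geometry.Riemannian

namespace Summit.SmoothPoincare4.SmoothPoincare4.Cruxes.ConicalGap.ConfinedKaehlerSplit

/-! ## Registered stubs (v1) -/

/-- Stub K — KNOWN IN PRINT (Conlon–Deruelle–Sun 2024 Thm E(3) [arXiv: Thm 5(3), "Classification of shrinkers"]: Kähler ∧ `R → 0` ⇒ flat or FIK; `Θ(FIK) = .672 < .791`):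
the density gap on the KÄHLER asymptotically conical class — complete connected non-compact non-flat normalised 4-d
gradient shrinkers with `R → 0` at infinity carrying a `g`-orthogonal almost complex structure `J` parallel for the
Levi-Civita connection.  Lean debt XL (CDS Thm E(3) as a named fact + the FIK model). -/
theorem stub_kaehlerConicalGap :
    ∀ (M : Type) [TopologicalSpace M] [T2Space M] [SecondCountableTopology M] [ChartedSpace (EuclideanSpace ℝ (Fin
    4)) M] [IsManifold (𝓡 4) ∞ M] [ConnectedSpace M] [NoncompactSpace M] [T3Space M] [MeasurableSpace M]
    [BorelSpace M] (g : Literature.Geometry.Lorentzian.PseudoRiemannianMetric (𝓡 4) ∞ (EuclideanSpace ℝ (Fin 4))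
    (TangentSpace (𝓡 4) : M → Type _)) [g.HasLeviCivita] (f : M → ℝ) (hg : g.IsRiemannian), (∀ (x : M) (r :
    NNReal), IsCompact {y : M | g.edist hg x y ≤ r}) → ContMDiff (𝓡 4) 𝓘(ℝ, ℝ) ∞ f → (∀ (x : M) (X Y :
    TangentSpace (𝓡 4) x), g.ricci x X Y + g.hessian f x X Y = (1 / 2 : ℝ) * g.val x X Y) → (∀ x : M,
    g.scalarCurvature x + g.gradSq f x = f x) → (∃ x : M, g.scalarCurvature x ≠ 0) → (∀ ε : ℝ, 0 < ε → ∃ K : Set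
    M, IsCompact K ∧ ∀ x, x ∉ K → g.scalarCurvature x < ε) → (∃ J : (∀ x : M, TangentSpace (𝓡 4) x →L[ℝ]
    TangentSpace (𝓡 4) x), (∀ (x : M) (v : TangentSpace (𝓡 4) x), J x (J x v) = -v) ∧ (∀ (x : M) (v w :
    TangentSpace (𝓡 4) x), g.val x (J x v) (J x w) = g.val x v w) ∧ (∀ Y : (∀ x : M, TangentSpace (𝓡 4) x), (∀ x :
    M, MDifferentiableAt (𝓡 4) ((𝓡 4).prod 𝓘(ℝ, EuclideanSpace ℝ (Fin 4))) (fun y : M ↦ Bundle.TotalSpace.mk'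
    (EuclideanSpace ℝ (Fin 4)) y (Y y)) x) → (∀ x : M, MDifferentiableAt (𝓡 4) ((𝓡 4).prod 𝓘(ℝ, EuclideanSpace ℝ
    (Fin 4))) (fun y : M ↦ Bundle.TotalSpace.mk' (EuclideanSpace ℝ (Fin 4)) y (J y (Y y))) x) ∧ ∀ (x : M) (v :
    TangentSpace (𝓡 4) x), g.leviCivita (fun y : M ↦ J y (Y y)) x v = J x (g.leviCivita Y x v))) → ∫⁻ x,
    ENNReal.ofReal (Real.exp (-f x)) ∂(Literature.Geometry.Lorentzian.riemannianMeasure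
    (g.toContMDiffRiemannianMetric hg)) ≤ ENNReal.ofReal (32 * Real.pi ^ 2 * Real.sqrt Real.pi * Real.exp (-(3 :
    ℝ) / 2)) := by
  sorry

/-- Stub C — THE SUMMIT-RELEVANT OPEN CORE (hardest stub; no example known, no theorem in print): the density gap for
NON-Kähler asymptotically conical shrinkers that are CONFINED (every sublevel set `{f < t}` embeds, by an open smooth
embedding with smooth left inverse, into one smooth closed 4-manifold homotopy equivalent to `S⁴`) — exactly the instance
the rung `RecognitionOfShrinkerGaps` / `closes` consumes. -/
theorem stub_confinedNonKaehlerConicalGap :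
    ∀ (M : Type) [TopologicalSpace M] [T2Space M] [SecondCountableTopology M] [ChartedSpace (EuclideanSpace ℝ (Fin
    4)) M] [IsManifold (𝓡 4) ∞ M] [ConnectedSpace M] [NoncompactSpace M] [T3Space M] [MeasurableSpace M]
    [BorelSpace M] (g : Literature.Geometry.Lorentzian.PseudoRiemannianMetric (𝓡 4) ∞ (EuclideanSpace ℝ (Fin 4))
    (TangentSpace (𝓡 4) : M → Type _)) [g.HasLeviCivita] (f : M → ℝ) (hg : g.IsRiemannian), (∀ (x : M) (r :
    NNReal), IsCompact {y : M | g.edist hg x y ≤ r}) → ContMDiff (𝓡 4) 𝓘(ℝ, ℝ) ∞ f → (∀ (x : M) (X Y :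
    TangentSpace (𝓡 4) x), g.ricci x X Y + g.hessian f x X Y = (1 / 2 : ℝ) * g.val x X Y) → (∀ x : M,
    g.scalarCurvature x + g.gradSq f x = f x) → (∃ x : M, g.scalarCurvature x ≠ 0) → (∀ ε : ℝ, 0 < ε → ∃ K : Set
    M, IsCompact K ∧ ∀ x, x ∉ K → g.scalarCurvature x < ε) → ¬ (∃ J : (∀ x : M, TangentSpace (𝓡 4) x →L[ℝ]
    TangentSpace (𝓡 4) x), (∀ (x : M) (v : TangentSpace (𝓡 4) x), J x (J x v) = -v) ∧ (∀ (x : M) (v w :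
    TangentSpace (𝓡 4) x), g.val x (J x v) (J x w) = g.val x v w) ∧ (∀ Y : (∀ x : M, TangentSpace (𝓡 4) x), (∀ x :
    M, MDifferentiableAt (𝓡 4) ((𝓡 4).prod 𝓘(ℝ, EuclideanSpace ℝ (Fin 4))) (fun y : M ↦ Bundle.TotalSpace.mk'
    (EuclideanSpace ℝ (Fin 4)) y (Y y)) x) → (∀ x : M, MDifferentiableAt (𝓡 4) ((𝓡 4).prod 𝓘(ℝ, EuclideanSpace ℝ
    (Fin 4))) (fun y : M ↦ Bundle.TotalSpace.mk' (EuclideanSpace ℝ (Fin 4)) y (J y (Y y))) x) ∧ ∀ (x : M) (v :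
    TangentSpace (𝓡 4) x), g.leviCivita (fun y : M ↦ J y (Y y)) x v = J x (g.leviCivita Y x v))) → (∃ (S : Type)
    (_ : TopologicalSpace S) (_ : T2Space S) (_ : SecondCountableTopology S) (_ : ChartedSpace (EuclideanSpace ℝ
    (Fin 4)) S) (_ : IsManifold (𝓡 4) ∞ S) (_ : CompactSpace S), Nonempty (ContinuousMap.HomotopyEquiv S
    (Metric.sphere (0 : EuclideanSpace ℝ (Fin 5)) 1)) ∧ ∀ t : ℝ, ∃ (Φ : M → S) (Ψ : S → M), ContMDiffOn (𝓡 4) (𝓡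
    4) ∞ Φ {x : M | f x < t} ∧ IsOpen (Φ '' {x : M | f x < t}) ∧ ContMDiffOn (𝓡 4) (𝓡 4) ∞ Ψ (Φ '' {x : M | f x <
    t}) ∧ ∀ x ∈ {x : M | f x < t}, Ψ (Φ x) = x) → ∫⁻ x, ENNReal.ofReal (Real.exp (-f x))
    ∂(Literature.Geometry.Lorentzian.riemannianMeasure (g.toContMDiffRiemannianMetric hg)) ≤ ENNReal.ofReal (32 *
    Real.pi ^ 2 * Real.sqrt Real.pi * Real.exp (-(3 : ℝ) / 2)) := by
  sorry

/-- Stub U — GRATUITOUS GENERALITY (not needed by `closes` after a confinement re-glue of the rung; disprover target):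
the density gap for non-Kähler asymptotically conical shrinkers that are NOT confined. -/
theorem stub_unconfinedNonKaehlerConicalGap :
    ∀ (M : Type) [TopologicalSpace M] [T2Space M] [SecondCountableTopology M] [ChartedSpace (EuclideanSpace ℝ (Fin
    4)) M] [IsManifold (𝓡 4) ∞ M] [ConnectedSpace M] [NoncompactSpace M] [T3Space M] [MeasurableSpace M]
    [BorelSpace M] (g : Literature.Geometry.Lorentzian.PseudoRiemannianMetric (𝓡 4) ∞ (EuclideanSpace ℝ (Fin 4))
    (TangentSpace (𝓡 4) : M → Type _)) [g.HasLeviCivita] (f : M → ℝ) (hg : g.IsRiemannian), (∀ (x : M) (r :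
    NNReal), IsCompact {y : M | g.edist hg x y ≤ r}) → ContMDiff (𝓡 4) 𝓘(ℝ, ℝ) ∞ f → (∀ (x : M) (X Y :
    TangentSpace (𝓡 4) x), g.ricci x X Y + g.hessian f x X Y = (1 / 2 : ℝ) * g.val x X Y) → (∀ x : M,
    g.scalarCurvature x + g.gradSq f x = f x) → (∃ x : M, g.scalarCurvature x ≠ 0) → (∀ ε : ℝ, 0 < ε → ∃ K : Set
    M, IsCompact K ∧ ∀ x, x ∉ K → g.scalarCurvature x < ε) → ¬ (∃ J : (∀ x : M, TangentSpace (𝓡 4) x →L[ℝ]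
    TangentSpace (𝓡 4) x), (∀ (x : M) (v : TangentSpace (𝓡 4) x), J x (J x v) = -v) ∧ (∀ (x : M) (v w :
    TangentSpace (𝓡 4) x), g.val x (J x v) (J x w) = g.val x v w) ∧ (∀ Y : (∀ x : M, TangentSpace (𝓡 4) x), (∀ x :
    M, MDifferentiableAt (𝓡 4) ((𝓡 4).prod 𝓘(ℝ, EuclideanSpace ℝ (Fin 4))) (fun y : M ↦ Bundle.TotalSpace.mk'
    (EuclideanSpace ℝ (Fin 4)) y (Y y)) x) → (∀ x : M, MDifferentiableAt (𝓡 4) ((𝓡 4).prod 𝓘(ℝ, EuclideanSpace ℝ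
    (Fin 4))) (fun y : M ↦ Bundle.TotalSpace.mk' (EuclideanSpace ℝ (Fin 4)) y (J y (Y y))) x) ∧ ∀ (x : M) (v :
    TangentSpace (𝓡 4) x), g.leviCivita (fun y : M ↦ J y (Y y)) x v = J x (g.leviCivita Y x v))) → ¬ (∃ (S : Type)
    (_ : TopologicalSpace S) (_ : T2Space S) (_ : SecondCountableTopology S) (_ : ChartedSpace (EuclideanSpace ℝ
    (Fin 4)) S) (_ : IsManifold (𝓡 4) ∞ S) (_ : CompactSpace S), Nonempty (ContinuousMap.HomotopyEquiv S
    (Metric.sphere (0 : EuclideanSpace ℝ (Fin 5)) 1)) ∧ ∀ t : ℝ, ∃ (Φ : M → S) (Ψ : S → M), ContMDiffOn (𝓡 4) (𝓡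
    4) ∞ Φ {x : M | f x < t} ∧ IsOpen (Φ '' {x : M | f x < t}) ∧ ContMDiffOn (𝓡 4) (𝓡 4) ∞ Ψ (Φ '' {x : M | f x <
    t}) ∧ ∀ x ∈ {x : M | f x < t}, Ψ (Φ x) = x) → ∫⁻ x, ENNReal.ofReal (Real.exp (-f x))
    ∂(Literature.Geometry.Lorentzian.riemannianMeasure (g.toContMDiffRiemannianMetric hg)) ≤ ENNReal.ofReal (32 *
    Real.pi ^ 2 * Real.sqrt Real.pi * Real.exp (-(3 : ℝ) / 2)) := by
  sorry

/-! ## The composition (sorry-free; concludes the crux BY NAME) -/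

/-- **`ConicalGap_of`** (v1): the crux BY NAME from the three registered stubs — excluded middle on "Kähler" and on
"confined" (a partition of the crux class, so the conjunction of the stubs is equivalent to the crux). -/
theorem ConicalGap_of : Summit.SmoothPoincare4.SmoothPoincare4.Theses.EntropyRung.ConicalGap := by
  intro M _ _ _ _ _ _ _ _ _ _ g _ f hg hc hf hsol hnorm hnf hdec
  by_cases hJ : (∃ J : (∀ x : M, TangentSpace (𝓡 4) x →L[ℝ] TangentSpace (𝓡 4) x), (∀ (x : M) (v : TangentSpace (𝓡 4) x), J x
    (J x v) = -v) ∧ (∀ (x : M) (v w : TangentSpace (𝓡 4) x), g.val x (J x v) (J x w) = g.val x v w) ∧ (∀ Y : (∀ x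
    : M, TangentSpace (𝓡 4) x), (∀ x : M, MDifferentiableAt (𝓡 4) ((𝓡 4).prod 𝓘(ℝ, EuclideanSpace ℝ (Fin 4))) (fun
    y : M ↦ Bundle.TotalSpace.mk' (EuclideanSpace ℝ (Fin 4)) y (Y y)) x) → (∀ x : M, MDifferentiableAt (𝓡 4) ((𝓡
    4).prod 𝓘(ℝ, EuclideanSpace ℝ (Fin 4))) (fun y : M ↦ Bundle.TotalSpace.mk' (EuclideanSpace ℝ (Fin 4)) y (J y
    (Y y))) x) ∧ ∀ (x : M) (v : TangentSpace (𝓡 4) x), g.leviCivita (fun y : M ↦ J y (Y y)) x v = J x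
    (g.leviCivita Y x v)))
  · exact stub_kaehlerConicalGap M g f hg hc hf hsol hnorm hnf hdec hJ
  · by_cases hS : (∃ (S : Type) (_ : TopologicalSpace S) (_ : T2Space S) (_ : SecondCountableTopology S) (_ : ChartedSpace
      (EuclideanSpace ℝ (Fin 4)) S) (_ : IsManifold (𝓡 4) ∞ S) (_ : CompactSpace S), Nonempty
      (ContinuousMap.HomotopyEquiv S (Metric.sphere (0 : EuclideanSpace ℝ (Fin 5)) 1)) ∧ ∀ t : ℝ, ∃ (Φ : M → S) (Ψ :
      S → M), ContMDiffOn (𝓡 4) (𝓡 4) ∞ Φ {x : M | f x < t} ∧ IsOpen (Φ '' {x : M | f x < t}) ∧ ContMDiffOn (𝓡 4) (𝓡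
      4) ∞ Ψ (Φ '' {x : M | f x < t}) ∧ ∀ x ∈ {x : M | f x < t}, Ψ (Φ x) = x)
    · exact stub_confinedNonKaehlerConicalGap M g f hg hc hf hsol hnorm hnf hdec hJ hS
    · exact stub_unconfinedNonKaehlerConicalGap M g f hg hc hf hsol hnorm hnf hdec hJ hS

/-! ## Disproof used: the Gaussian witness sits under K's (and C's) extra hypotheses, so non-flatness stays load-bearing
stub-wise; the landed negative lemma is re-checked here against the line's imports. -/

example := @Summit.SmoothPoincare4.SmoothPoincare4.Theorems.ConicalGap.Negative.conicalGap_false_without_nonflat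

end Summit.SmoothPoincare4.SmoothPoincare4.Cruxes.ConicalGap.ConfinedKaehlerSplit

end
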